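import Literature.Analysis.FluidPDE.PassiveVectorTensorUniqueness
import Literature.Analysis.FluidPDE.PassiveVectorModeEnergy
import HarnessLib

/-!
# Weak passive-vector solutions with a constant viscosity TENSOR: the energy identity of one Fourier
# mode and the modewise dissipation bound (tensor twin of `PassiveVectorModeEnergy` +
# `PassiveVectorGalerkinEnergy`)

Analysis/FluidPDE proof-support file (everything proved; no new definitions). First brick of the
Fourier energy argument for the weak class `Torus.IsWeakTensorPassiveVectorOn A T 𝔸 b w₀ w`
(`∂ₜw + (b·∇)w + A (w·∇)b + ∇π = 𝓛_𝔸 w`, `∇·w = 0`, `𝓛_𝔸` Frisch's anisotropic eddy viscosity (9.57),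
constant fourth-order tensor `𝔸`, NO symmetry assumed). With `ŵ(t)(k) = 𝓕(complexify ∘ w(t))(k)`,
`F_j = 𝓕(bⱼ w)`, `G_j = 𝓕(wⱼ b)`, the symbol matrix `T_𝔸(k)` (`Torus.symbT`) and the linear forms
`B_τ(z) = ∑ⱼ 2πikⱼ ⟪F_j(τ)(k), z⟫ + A ∑ⱼ 2πikⱼ ⟪G_j(τ)(k), z⟫`,
`H_τ(z) = −4π² ⟪ŵ(τ)(k), T_𝔸(k) z⟫ + B_τ(z)` (so that `⟪ŵ(t)(k), z⟫ = ⟪ŵ₀(k), z⟫ + ∫₀ᵗ H_τ(z) dτ`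
for transversal `z`, `PassiveVectorTensorFourier.ae_inner_mFourierCoeff_eq`):

* `IsWeakTensorPassiveVectorOn.ae_mode_energy_eq` — physical-space form: for a smooth divergence-free
  steady field `G`, `(∫⟪w(t), G⟫)² = (∫⟪w₀, G⟫)² + 2 ∫_{(0,t]} Φ_G(τ) (∫⟪w(τ), G⟫) dτ`,
  `Φ_G = ∫⟪w, (b·∇)G + 𝓛_𝔸^* G⟫ + A ∫⟪b, (w·∇)G⟫`;
* `IsWeakTensorPassiveVectorOn.ae_sq_norm_inner_mFourierCoeff_eq` — for transversal `z`, with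
  `α(t) = ⟪ŵ(t)(k), z⟫`: `|α(t)|² = |α(0)|² + 2 ∫_{(0,t]} Re (conj α(τ) · H_τ(z)) dτ` for a.e. `t`;
* `IsWeakTensorPassiveVectorOn.ae_sq_norm_mFourierCoeff_eq` — **the energy identity of one mode,
  vector form** (datum `w₀ ∈ L²` weakly divergence free): for a.e. `t`,
  `‖ŵ(t)(k)‖² = ‖ŵ₀(k)‖² + 2 ∫_{(0,t]} Re (−4π² ⟪ŵ(τ)(k), T_𝔸(k) ŵ(τ)(k)⟫ + B_τ(ŵ(τ)(k))) dτ`.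
  Proof: instead of the Leray frame of the scalar file we sum the tested identities over an
  orthonormal basis `(eᵢ)` of `k^⊥ ⊂ ℂ^d` (`Σᵢ |⟪X, eᵢ⟫|² = ‖X‖²`, `Σᵢ conj⟪X, eᵢ⟫ H(eᵢ) = H(X)` for
  `X ∈ k^⊥` by `ℂ`-linearity of `H`); the mode `k = 0` is constant in time (`T_𝔸(0) = 0`);
* `IsWeakTensorPassiveVectorOn.ae_sq_norm_add_dissipation_le` — **the modewise dissipation bound**
  in a Legendre–Hadamard window `NearIso 𝔸 lo hi`, `0 < lo`, carrier bounded by `M`: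
  `‖ŵ(t)(k)‖² + 4π² lo |k|² ∫_{(0,t]} ‖ŵ(τ)(k)‖² dτ ≤ ‖ŵ₀(k)‖² + ((1+A²)/lo) ∫_{(0,t]} γ_k`,
  `γ_k = ∑ⱼ (‖F_j(k)‖² + ‖G_j(k)‖²)` (coercivity `lo|k|²‖X‖² ≤ Re ⟪X, T_𝔸(k)X⟫` on `k^⊥`,
  `PassiveVectorTensorUniqueness.lo_mul_le_re_inner_symbT`, and Young) — the scalar statement with
  `ν ↦ lo` (Robinson–Rodrigo–Sadowski 2016, (4.20), mode by mode).

Cell `ad-ideate`, tensor twin energy layer E1 (consumers: K1L `LagrangianRenormalisationStep`, stub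
`stub_baseT`: decay of EVERY weak tensor-class solution).

## Mathlib / tree search

Tree: `PassiveVectorModeEnergy`, `PassiveVectorGalerkinEnergy` (scalar twins), `PassiveVectorTensorFourier`
(`ae_inner_mFourierCoeff_eq`, `integrableOn_modeRHS`, `symbT_*`), `PassiveVectorTensorUniqueness`
(`lo_mul_le_re_inner_symbT`, `mem_orthogonal_waveVec_iff`, `ae_tsum_enorm_sq_mFourierCoeff_products_le`,
`ae_sum_mul_mFourierCoeff_eq_zero`), `PassiveVectorTensorClass` (`ae_integral_inner_eq`),
`PassiveScalarEnergyMollified.sq_const_add_setIntegral_eq`.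

## References

* J. C. Robinson, J. L. Rodrigo, W. Sadowski, *The three-dimensional Navier–Stokes equations*
  (CUP 2016), §4.2 (Galerkin energy estimate (4.20)), Ch. 2 Def. 2.8. [`RobinsonRodrigoSadowski2016`]
* U. Frisch, *Turbulence* (CUP 1995), §9.6.3 eq. (9.57) p. 233. [`Frisch1995Turbulence`]
* M. Giaquinta, *Multiple integrals in the calculus of variations and nonlinear elliptic systems*
  (Princeton 1983), Ch. III §2 (2.2). [`Giaquinta1983MultipleIntegrals`]
* R. J. DiPerna, P.-L. Lions, Invent. Math. 98 (1989), §II.1, (12)–(14). [`DiPernaLions1989`]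
-/

noncomputable section

open MeasureTheory Set Filter Function TopologicalSpace Complex UnitAddTorus
open scoped ENNReal NNReal InnerProductSpace ComplexConjugate

namespace Literature.Analysis.FluidPDE

namespace Torus

variable {d : Type*} [Fintype d]

/-! ## Scalar lemmas -/

section Scalar

/-- Product rule for an a.e. primitive with datum: `U(t) = c + ∫_{(0,t]} F` a.e. with `F ∈ L¹(0,T)`
gives `U(t)² = c² + 2 ∫_{(0,t]} F U` a.e. [folklore] -/
private theorem ae_sq_eq_of_ae_eq_add_setIntegral₄ {T c : ℝ} {U F : ℝ → ℝ} (hF : IntegrableOn F (Ioo 0 T) volume)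
    (hU : ∀ᵐ t ∂(volume.restrict (Ioo 0 T)), U t = c + ∫ τ in Ioc 0 t, F τ) :
    ∀ᵐ t ∂(volume.restrict (Ioo 0 T)), U t ^ 2 = c ^ 2 + 2 * ∫ τ in Ioc 0 t, F τ * U τ := by
  have hU' : ∀ᵐ τ ∂(volume : Measure ℝ), τ ∈ Ioo 0 T → U τ = c + ∫ r in Ioc 0 τ, F r :=
    (ae_restrict_iff' measurableSet_Ioo).1 hU
  filter_upwards [hU, ae_restrict_mem measurableSet_Ioo] with t ht htT
  have hsub : Ioc 0 t ⊆ Ioo 0 T := Ioc_subset_Ioo_right htT.2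
  rw [ht, sq_const_add_setIntegral_eq (hF.mono_set hsub)]
  congr 1
  congr 1
  refine setIntegral_congr_ae measurableSet_Ioc ?_
  filter_upwards [hU'] with τ hτ hτI
  rw [hτ (hsub hτI)]

/-- `Re a · Re h + Im a · Im h = Re (conj a · h)`. [folklore] -/
private theorem re_mul_re_add_im_mul_im₄ (a h : ℂ) : a.re * h.re + a.im * h.im = (conj a * h).re := by
  simp [Complex.mul_re, Complex.conj_re, Complex.conj_im]

/-- `‖a‖² = (Re a)² + (Im a)²`. [folklore] -/
private theorem norm_sq_eq_re_sq_add_im_sq₄ (a : ℂ) : ‖a‖ ^ 2 = a.re ^ 2 + a.im ^ 2 := by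
  rw [Complex.sq_norm, Complex.normSq_apply]
  ring

/-- `∫ ‖f‖ ≤ C` from `‖f‖_{L²} ≤ C` on the probability space `T^d`. [folklore] -/
private theorem integral_norm_le_of_eLpNorm_two_le₄ {f : UnitAddTorus d → EuclideanSpace ℝ d}
    (hf : MemLp f 2 volume) {C : ℝ≥0} (h : eLpNorm f 2 volume ≤ C) : ∫ x, ‖f x‖ ≤ C := by
  have h1 : ENNReal.ofReal (∫ x, ‖f x‖) = eLpNorm f 1 volume := by
    rw [eLpNorm_one_eq_lintegral_enorm, ← ofReal_integral_norm_eq_lintegral_enorm (hf.integrable one_le_two)]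
  have h2 : ENNReal.ofReal (∫ x, ‖f x‖) ≤ C :=
    h1.le.trans ((eLpNorm_le_eLpNorm_of_exponent_le (by norm_num) hf.1).trans h)
  have := (ENNReal.ofReal_le_iff_le_toReal ENNReal.coe_ne_top).1 h2
  simpa using this

/-- `‖𝓕(complexify ∘ f)(k)‖ ≤ ∫ ‖f‖` for integrable `f`. [folklore] -/
private theorem norm_mFourierCoeff_complexify_le₄ {f : UnitAddTorus d → EuclideanSpace ℝ d}
    (hf : Integrable f volume) (k : d → ℤ) :
    ‖mFourierCoeff (FunctionSpaces.EuclideanSpace.complexify ∘ f) k‖ ≤ ∫ x, ‖f x‖ := by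
  rw [FunctionSpaces.Torus.mFourierCoeff_eq_integral_volume]
  have hint : Integrable (fun x => mFourier (-k) x • (FunctionSpaces.EuclideanSpace.complexify ∘ f) x) volume :=
    FunctionSpaces.Torus.integrable_mFourier_smul' (FunctionSpaces.Torus.integrable_complexify_comp hf) k
  refine (norm_integral_le_integral_norm _).trans (integral_mono hint.norm hf.norm fun x => ?_)
  dsimp only
  rw [norm_smul, Function.comp_apply, FunctionSpaces.EuclideanSpace.norm_complexify]
  exact mul_le_of_le_one_left (norm_nonneg _) (((mFourier (-k)).norm_coe_le_norm x).trans_eq mFourier_norm)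

/-- `(a + |A| b)² ≤ (1 + A²)(a² + b²)`. [folklore] -/
private theorem sq_add_abs_mul_le₄ (A a b : ℝ) : (a + |A| * b) ^ 2 ≤ (1 + A ^ 2) * (a ^ 2 + b ^ 2) := by
  nlinarith [sq_nonneg (|A| * a - b), sq_abs A]

/-- `‖B(z)‖² ≤ 4π²|k|² (1 + A²) ‖z‖² ∑ⱼ (‖Fⱼ‖² + ‖Gⱼ‖²)` (Cauchy–Schwarz). [folklore] -/
private theorem norm_sq_modeRHS_le₄ (A : ℝ) (k : d → ℤ) (z : EuclideanSpace ℂ d) (F G : d → EuclideanSpace ℂ d) :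
    ‖(∑ j, (2 * Real.pi * I * (k j)) * ⟪F j, z⟫_ℂ) + (A : ℂ) * ∑ j, (2 * Real.pi * I * (k j)) * ⟪G j, z⟫_ℂ‖ ^ 2 ≤
      4 * Real.pi ^ 2 * FunctionSpaces.Torus.freqNormSq k * ((1 + A ^ 2) * ‖z‖ ^ 2) *
        ∑ j, (‖F j‖ ^ 2 + ‖G j‖ ^ 2) := by
  have hkj : ∀ j, ‖(2 * Real.pi * I * (k j) : ℂ)‖ = 2 * Real.pi * |(k j : ℝ)| := by
    intro j
    rw [norm_mul, norm_mul, norm_mul, Complex.norm_I, mul_one, Complex.norm_intCast, Complex.norm_real,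
      Real.norm_eq_abs, abs_of_pos Real.pi_pos, ← Int.cast_abs, Int.cast_abs]
    norm_num
  have h1 : ‖(∑ j, (2 * Real.pi * I * (k j)) * ⟪F j, z⟫_ℂ) + (A : ℂ) * ∑ j, (2 * Real.pi * I * (k j)) * ⟪G j, z⟫_ℂ‖ ≤
      ∑ j, (2 * Real.pi * |(k j : ℝ)|) * (‖z‖ * (‖F j‖ + |A| * ‖G j‖)) := by
    rw [Finset.mul_sum, ← Finset.sum_add_distrib]
    refine (norm_sum_le _ _).trans (Finset.sum_le_sum fun j _ => ?_)
    have a1 : ‖(2 * Real.pi * I * (k j)) * ⟪F j, z⟫_ℂ‖ ≤ 2 * Real.pi * |(k j : ℝ)| * (‖F j‖ * ‖z‖) := by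
      rw [norm_mul, hkj]
      exact mul_le_mul_of_nonneg_left (norm_inner_le_norm _ _) (by positivity)
    have a2 : ‖(A : ℂ) * ((2 * Real.pi * I * (k j)) * ⟪G j, z⟫_ℂ)‖ ≤
        |A| * (2 * Real.pi * |(k j : ℝ)| * (‖G j‖ * ‖z‖)) := by
      rw [norm_mul, norm_mul, hkj, Complex.norm_real, Real.norm_eq_abs]
      exact mul_le_mul_of_nonneg_left (mul_le_mul_of_nonneg_left (norm_inner_le_norm _ _) (by positivity))
        (abs_nonneg _)
    calc ‖(2 * Real.pi * I * (k j)) * ⟪F j, z⟫_ℂ + (A : ℂ) * ((2 * Real.pi * I * (k j)) * ⟪G j, z⟫_ℂ)‖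
        ≤ ‖(2 * Real.pi * I * (k j)) * ⟪F j, z⟫_ℂ‖ + ‖(A : ℂ) * ((2 * Real.pi * I * (k j)) * ⟪G j, z⟫_ℂ)‖ :=
          norm_add_le _ _
      _ ≤ 2 * Real.pi * |(k j : ℝ)| * (‖F j‖ * ‖z‖) + |A| * (2 * Real.pi * |(k j : ℝ)| * (‖G j‖ * ‖z‖)) :=
          add_le_add a1 a2
      _ = 2 * Real.pi * |(k j : ℝ)| * (‖z‖ * (‖F j‖ + |A| * ‖G j‖)) := by ring
  have h2 : (∑ j, (2 * Real.pi * |(k j : ℝ)|) * (‖z‖ * (‖F j‖ + |A| * ‖G j‖))) ^ 2 ≤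
      (∑ j, (2 * Real.pi * |(k j : ℝ)|) ^ 2) * ∑ j, (‖z‖ * (‖F j‖ + |A| * ‖G j‖)) ^ 2 :=
    Finset.sum_mul_sq_le_sq_mul_sq _ _ _
  have h3 : ∑ j, (2 * Real.pi * |(k j : ℝ)|) ^ 2 = 4 * Real.pi ^ 2 * FunctionSpaces.Torus.freqNormSq k := by
    rw [FunctionSpaces.Torus.freqNormSq, Finset.mul_sum]
    exact Finset.sum_congr rfl fun j _ => by rw [mul_pow, sq_abs]; ring
  have h4 : ∑ j, (‖z‖ * (‖F j‖ + |A| * ‖G j‖)) ^ 2 ≤ (1 + A ^ 2) * ‖z‖ ^ 2 * ∑ j, (‖F j‖ ^ 2 + ‖G j‖ ^ 2) := by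
    rw [Finset.mul_sum]
    refine Finset.sum_le_sum fun j _ => ?_
    rw [mul_pow]
    calc ‖z‖ ^ 2 * (‖F j‖ + |A| * ‖G j‖) ^ 2 ≤ ‖z‖ ^ 2 * ((1 + A ^ 2) * (‖F j‖ ^ 2 + ‖G j‖ ^ 2)) :=
          mul_le_mul_of_nonneg_left (sq_add_abs_mul_le₄ A _ _) (sq_nonneg _)
      _ = (1 + A ^ 2) * ‖z‖ ^ 2 * (‖F j‖ ^ 2 + ‖G j‖ ^ 2) := by ring
  have hN0 := FunctionSpaces.Torus.freqNormSq_nonneg k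
  calc ‖(∑ j, (2 * Real.pi * I * (k j)) * ⟪F j, z⟫_ℂ) + (A : ℂ) * ∑ j, (2 * Real.pi * I * (k j)) * ⟪G j, z⟫_ℂ‖ ^ 2
      ≤ (∑ j, (2 * Real.pi * |(k j : ℝ)|) * (‖z‖ * (‖F j‖ + |A| * ‖G j‖))) ^ 2 :=
        pow_le_pow_left₀ (norm_nonneg _) h1 2
    _ ≤ (∑ j, (2 * Real.pi * |(k j : ℝ)|) ^ 2) * ∑ j, (‖z‖ * (‖F j‖ + |A| * ‖G j‖)) ^ 2 := h2
    _ ≤ (4 * Real.pi ^ 2 * FunctionSpaces.Torus.freqNormSq k) *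
          ((1 + A ^ 2) * ‖z‖ ^ 2 * ∑ j, (‖F j‖ ^ 2 + ‖G j‖ ^ 2)) := by
        rw [h3]
        exact mul_le_mul_of_nonneg_left h4 (by positivity)
    _ = 4 * Real.pi ^ 2 * FunctionSpaces.Torus.freqNormSq k * ((1 + A ^ 2) * ‖z‖ ^ 2) *
          ∑ j, (‖F j‖ ^ 2 + ‖G j‖ ^ 2) := by ring

/-- Young's inequality for the mode right-hand side tested against the mode itself (`lo > 0`):
`2 Re B(X) ≤ 4π² lo |k|² ‖X‖² + ((1 + A²)/lo) ∑ⱼ (‖Fⱼ‖² + ‖Gⱼ‖²)`. [folklore] -/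
private theorem two_mul_re_modeRHS_le₄ {lo : ℝ} (hlo : 0 < lo) (A : ℝ) (k : d → ℤ) (X : EuclideanSpace ℂ d)
    (F G : d → EuclideanSpace ℂ d) :
    2 * ((∑ j, (2 * Real.pi * I * (k j)) * ⟪F j, X⟫_ℂ) + (A : ℂ) * ∑ j, (2 * Real.pi * I * (k j)) * ⟪G j, X⟫_ℂ).re ≤
      4 * Real.pi ^ 2 * lo * FunctionSpaces.Torus.freqNormSq k * ‖X‖ ^ 2 +
        ((1 + A ^ 2) / lo) * ∑ j, (‖F j‖ ^ 2 + ‖G j‖ ^ 2) := by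
  set B : ℂ := (∑ j, (2 * Real.pi * I * (k j)) * ⟪F j, X⟫_ℂ) + (A : ℂ) * ∑ j, (2 * Real.pi * I * (k j)) * ⟪G j, X⟫_ℂ
    with hB
  set a : ℝ := 4 * Real.pi ^ 2 * lo * FunctionSpaces.Torus.freqNormSq k * ‖X‖ ^ 2 with ha
  set c : ℝ := ((1 + A ^ 2) / lo) * ∑ j, (‖F j‖ ^ 2 + ‖G j‖ ^ 2) with hc
  have hN0 := FunctionSpaces.Torus.freqNormSq_nonneg k
  have hγ0 : 0 ≤ ∑ j, (‖F j‖ ^ 2 + ‖G j‖ ^ 2) := Finset.sum_nonneg fun j _ => by positivity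
  have ha0 : 0 ≤ a := by positivity
  have hc0 : 0 ≤ c := by positivity
  have hsq : ‖B‖ ^ 2 ≤ a * c := by
    refine (norm_sq_modeRHS_le₄ A k X F G).trans (le_of_eq ?_)
    rw [ha, hc]
    field_simp
  have h2 : 2 * ‖B‖ ≤ a + c := by
    have h4 : (2 * ‖B‖) ^ 2 ≤ (a + c) ^ 2 := by nlinarith [hsq, sq_nonneg (a - c), norm_nonneg B]
    exact (pow_le_pow_iff_left₀ (by positivity) (by positivity) two_ne_zero).1 h4
  calc 2 * B.re ≤ 2 * ‖B‖ := by
        have := Complex.re_le_norm B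
        linarith
    _ ≤ a + c := h2

end Scalar

/-! ## Linear algebra of the symbol matrix and of the mode right-hand side -/

section SymbolAlgebra

/-- `T_𝔸(k)` is continuous (a linear map of a finite-dimensional space).
[cite: Frisch1995Turbulence, §9.6.3 eq. (9.57) p. 233] -/
theorem continuous_symbT (𝔸 : Visc4 d) (k : d → ℤ) : Continuous (symbT 𝔸 k) := by
  let L : EuclideanSpace ℂ d →ₗ[ℂ] EuclideanSpace ℂ d :=
    { toFun := symbT 𝔸 k
      map_add' := symbT_add 𝔸 k
      map_smul' := fun μ z => symbT_smul 𝔸 k μ z }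
  exact L.continuous_of_finiteDimensional

/-- `T_𝔸(k)` is bounded: `‖T_𝔸(k) z‖ ≤ C ‖z‖`. [cite: Frisch1995Turbulence, §9.6.3 eq. (9.57) p. 233] -/
theorem exists_norm_symbT_le (𝔸 : Visc4 d) (k : d → ℤ) :
    ∃ C : ℝ, 0 ≤ C ∧ ∀ z : EuclideanSpace ℂ d, ‖symbT 𝔸 k z‖ ≤ C * ‖z‖ := by
  let L : EuclideanSpace ℂ d →ₗ[ℂ] EuclideanSpace ℂ d :=
    { toFun := symbT 𝔸 k
      map_add' := symbT_add 𝔸 k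
      map_smul' := fun μ z => symbT_smul 𝔸 k μ z }
  refine ⟨‖LinearMap.toContinuousLinearMap L‖, norm_nonneg _, fun z => ?_⟩
  exact (LinearMap.toContinuousLinearMap L).le_opNorm z

/-- Pulling a scalar out of a transport sum. [folklore] -/
private theorem modeRHS_sumpull (k : d → ℤ) (μ : ℂ) (f : d → ℂ) :
    ∑ j, (2 * Real.pi * I * (k j)) * (μ * f j) = μ * ∑ j, (2 * Real.pi * I * (k j)) * f j := by
  rw [Finset.mul_sum]; exact Finset.sum_congr rfl fun j _ => by ring

/-- **The mode right-hand side `H(z) = −4π² ⟪X, T_𝔸(k) z⟫ + B(z)` is `ℂ`-linear in `z`**: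
`H(Σᵢ μᵢ eᵢ) = Σᵢ μᵢ H(eᵢ)`. [folklore] -/
private theorem modeRHS_sum_smul {ι : Type*} (s : Finset ι) (𝔸 : Visc4 d) (k : d → ℤ) (A : ℝ)
    (X : EuclideanSpace ℂ d) (F G : d → EuclideanSpace ℂ d) (μ : ι → ℂ) (e : ι → EuclideanSpace ℂ d) :
    (-(4 * Real.pi ^ 2 : ℝ) : ℂ) * ⟪X, symbT 𝔸 k (∑ i ∈ s, μ i • e i)⟫_ℂ +
        ((∑ j, (2 * Real.pi * I * (k j)) * ⟪F j, ∑ i ∈ s, μ i • e i⟫_ℂ) +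
          (A : ℂ) * ∑ j, (2 * Real.pi * I * (k j)) * ⟪G j, ∑ i ∈ s, μ i • e i⟫_ℂ) =
      ∑ i ∈ s, μ i * ((-(4 * Real.pi ^ 2 : ℝ) : ℂ) * ⟪X, symbT 𝔸 k (e i)⟫_ℂ +
        ((∑ j, (2 * Real.pi * I * (k j)) * ⟪F j, e i⟫_ℂ) + (A : ℂ) * ∑ j, (2 * Real.pi * I * (k j)) * ⟪G j, e i⟫_ℂ)) := by
  classical
  induction s using Finset.induction_on with
  | empty => simp
  | insert a s ha ih =>
    rw [Finset.sum_insert ha, Finset.sum_insert ha, ← ih]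
    simp only [symbT_add, symbT_smul, inner_add_right, inner_smul_right, mul_add, Finset.sum_add_distrib,
      modeRHS_sumpull]
    ring

/-- Parseval in a subspace: for `X ∈ S` and an orthonormal basis `(eᵢ)` of `S`,
`Σᵢ |⟪X, eᵢ⟫|² = ‖X‖²`. [folklore] -/
private theorem sum_sq_norm_inner_onb₄ {ι : Type*} [Fintype ι] {S : Submodule ℂ (EuclideanSpace ℂ d)}
    (b : OrthonormalBasis ι ℂ S) {X : EuclideanSpace ℂ d} (hX : X ∈ S) :
    ∑ i, ‖⟪X, (b i : EuclideanSpace ℂ d)⟫_ℂ‖ ^ 2 = ‖X‖ ^ 2 := by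
  have h1 : ‖(⟨X, hX⟩ : S)‖ ^ 2 = ∑ i, ‖b.repr ⟨X, hX⟩ i‖ ^ 2 := by
    rw [← b.repr.norm_map, EuclideanSpace.norm_sq_eq]
  have h2 : ∀ i, b.repr ⟨X, hX⟩ i = ⟪(b i : EuclideanSpace ℂ d), X⟫_ℂ := fun i => by
    rw [OrthonormalBasis.repr_apply_apply, Submodule.coe_inner]
  rw [show ‖X‖ = ‖(⟨X, hX⟩ : S)‖ from rfl, h1]
  refine Finset.sum_congr rfl fun i _ => ?_
  rw [h2, norm_inner_symm]

/-- Expansion in a subspace with conjugated coefficients: `Σᵢ conj⟪X, eᵢ⟫ eᵢ = X` for `X ∈ S`.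
[folklore] -/
private theorem sum_conj_inner_smul_onb₄ {ι : Type*} [Fintype ι] {S : Submodule ℂ (EuclideanSpace ℂ d)}
    (b : OrthonormalBasis ι ℂ S) {X : EuclideanSpace ℂ d} (hX : X ∈ S) :
    ∑ i, conj ⟪X, (b i : EuclideanSpace ℂ d)⟫_ℂ • (b i : EuclideanSpace ℂ d) = X := by
  have h := b.sum_repr' ⟨X, hX⟩
  have h' := congrArg (fun v : S => (v : EuclideanSpace ℂ d)) h
  simp only [Submodule.coe_sum, Submodule.coe_smul, Submodule.coe_inner] at h'
  simp_rw [inner_conj_symm]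
  exact h'

end SymbolAlgebra

/-! ## The energy identity of one mode, physical-space and tested forms -/

section ModeEnergy

variable [DecidableEq d]

namespace IsWeakTensorPassiveVectorOn

variable {A T : ℝ} {𝔸 : Visc4 d} {b w : ℝ → UnitAddTorus d → EuclideanSpace ℝ d}
  {w₀ : UnitAddTorus d → EuclideanSpace ℝ d}

/-- Integrability on `(0,T)` of the right-hand side `Φ_G = ∫⟪w, (b·∇)G + 𝓛_𝔸^* G⟫ + A ∫⟪b, (w·∇)G⟫` of
the steady-test identity, for a smooth steady field `G`. [cite: DiPernaLions1989, §II.1 (12)–(14)] -/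
theorem integrableOn_steadyRHS (h : IsWeakTensorPassiveVectorOn A T 𝔸 b w₀ w)
    {G : UnitAddTorus d → EuclideanSpace ℝ d} (hG : FunctionSpaces.Torus.IsSmooth G) :
    IntegrableOn (fun τ =>
      (∫ x, ⟪w τ x, FunctionSpaces.Torus.convect (b τ) G x + viscAdj 𝔸 G x⟫_ℝ) +
        A * ∫ x, ⟪b τ x, FunctionSpaces.Torus.convect (w τ) G x⟫_ℝ) (Ioo 0 T) volume := by
  have hG1 : FunctionSpaces.Torus.IsContDiff 1 G := hG.isContDiff (by simp)
  have hGd : ∀ j, Continuous (uncurry fun (_ : ℝ) (x : UnitAddTorus d) => FunctionSpaces.Torus.partialDeriv j G x) :=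
    fun j => (hG.partialDeriv j).continuous.comp continuous_snd
  have hGl : Continuous (uncurry fun (_ : ℝ) (x : UnitAddTorus d) => viscAdj 𝔸 G x) := by
    have hc : Continuous (viscAdj 𝔸 G) := (isSmooth_viscAdj 𝔸 hG).continuous
    exact hc.comp continuous_snd
  have hIv : Integrable (fun p : ℝ × UnitAddTorus d => ⟪w p.1 p.2, viscAdj 𝔸 G p.2⟫_ℝ)
      (((volume : Measure ℝ).restrict (Ioo 0 T)).prod volume) :=
    h.integrable_inner_of_continuous (Φ := fun _ x => viscAdj 𝔸 G x) hGl
  have hIc : Integrable (fun p : ℝ × UnitAddTorus d =>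
      ⟪w p.1 p.2, FunctionSpaces.Torus.convect (b p.1) G p.2⟫_ℝ)
      (((volume : Measure ℝ).restrict (Ioo 0 T)).prod volume) :=
    h.integrable_inner_convect (Φ := fun _ => G) (fun _ => hG1) hGd
  have hI₂ : Integrable (fun p : ℝ × UnitAddTorus d =>
      ⟪w p.1 p.2, FunctionSpaces.Torus.convect (b p.1) G p.2 + viscAdj 𝔸 G p.2⟫_ℝ)
      (((volume : Measure ℝ).restrict (Ioo 0 T)).prod volume) := by
    refine (hIc.add hIv).congr (Eventually.of_forall fun p => ?_)
    simp only [Pi.add_apply]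
    rw [inner_add_right]
  have hI₃ : Integrable (fun p : ℝ × UnitAddTorus d => A * ⟪b p.1 p.2, FunctionSpaces.Torus.convect (w p.1) G p.2⟫_ℝ)
      (((volume : Measure ℝ).restrict (Ioo 0 T)).prod volume) :=
    (h.integrable_inner_carrier_convect (Φ := fun _ => G) (fun _ => hG1) hGd).const_mul A
  refine (hI₂.integral_prod_left.add hI₃.integral_prod_left).congr (Eventually.of_forall fun t => ?_)
  simp only [Pi.add_apply]
  rw [integral_const_mul]

/-- The pairing with a continuous steady field is essentially bounded on `(0,T)`:
`|∫⟪w(τ), G⟫| ≤ K` for a.e. `τ`. [cite: DiPernaLions1989, §II.1 (12)–(14)] -/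
theorem exists_ae_abs_integral_inner_le (h : IsWeakTensorPassiveVectorOn A T 𝔸 b w₀ w)
    {G : UnitAddTorus d → EuclideanSpace ℝ d} (hG : Continuous G) :
    ∃ K : ℝ, ∀ᵐ τ ∂(volume.restrict (Ioo 0 T)), |∫ x, ⟪w τ x, G x⟫_ℝ| ≤ K := by
  obtain ⟨M, hM⟩ := (isCompact_univ.image hG).isBounded.exists_norm_le
  have hM' : ∀ x, ‖G x‖ ≤ M := fun x => hM _ ⟨x, mem_univ _, rfl⟩
  obtain ⟨C₁, hC₁⟩ := h.exists_eLpNorm_le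
  have h0 : 0 ≤ M := (norm_nonneg _).trans (hM' 0)
  refine ⟨M * C₁, ?_⟩
  filter_upwards [hC₁, h.ae_memLp_two] with τ hτ hm
  have hI : Integrable (w τ) volume := hm.integrable one_le_two
  calc |∫ x, ⟪w τ x, G x⟫_ℝ| ≤ ∫ x, M * ‖w τ x‖ := by
        rw [← Real.norm_eq_abs]
        refine norm_integral_le_of_norm_le (hI.norm.const_mul M) (Eventually.of_forall fun x => ?_)
        rw [mul_comm]
        exact (norm_inner_le_norm _ _).trans (mul_le_mul_of_nonneg_left (hM' x) (norm_nonneg _))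
    _ = M * ∫ x, ‖w τ x‖ := integral_const_mul _ _
    _ ≤ M * C₁ := mul_le_mul_of_nonneg_left (integral_norm_le_of_eLpNorm_two_le₄ hm hτ) h0

/-- **Per-mode energy identity, physical-space form** (tensor viscosity). For a smooth divergence-free
steady field `G` and a.e. `t ∈ (0,T)`:
`(∫⟪w(t), G⟫)² = (∫⟪w₀, G⟫)² + 2 ∫_{(0,t]} Φ_G(τ) (∫⟪w(τ), G⟫) dτ`,
`Φ_G(τ) = ∫⟪w(τ), (b(τ)·∇)G + 𝓛_𝔸^* G⟫ + A ∫⟪b(τ), (w(τ)·∇)G⟫`.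
[cite: RobinsonRodrigoSadowski2016, §4.2 (Galerkin energy estimate)] -/
theorem ae_mode_energy_eq (h : IsWeakTensorPassiveVectorOn A T 𝔸 b w₀ w)
    {G : UnitAddTorus d → EuclideanSpace ℝ d} (hG : FunctionSpaces.Torus.IsSmooth G)
    (hGdiv : FunctionSpaces.Torus.IsDivFree G) :
    ∀ᵐ t ∂(volume.restrict (Ioo 0 T)),
      (∫ x, ⟪w t x, G x⟫_ℝ) ^ 2 = (∫ x, ⟪w₀ x, G x⟫_ℝ) ^ 2 +
        2 * ∫ τ in Ioc 0 t,
          ((∫ x, ⟪w τ x, FunctionSpaces.Torus.convect (b τ) G x + viscAdj 𝔸 G x⟫_ℝ) +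
            A * ∫ x, ⟪b τ x, FunctionSpaces.Torus.convect (w τ) G x⟫_ℝ) * ∫ x, ⟪w τ x, G x⟫_ℝ :=
  ae_sq_eq_of_ae_eq_add_setIntegral₄ (h.integrableOn_steadyRHS hG) (h.ae_integral_inner_eq hG hGdiv)

/-- The Fourier modes of a weak solution are essentially bounded: `‖ŵ(τ)(k)‖ ≤ K` for a.e. `τ`
(`‖ŵ(τ)(k)‖ ≤ ‖w(τ)‖_{L¹} ≤ ‖w(τ)‖_{L²}`). [cite: RobinsonRodrigoSadowski2016, §4.2 (Galerkin energy estimate)] -/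
theorem exists_ae_norm_mFourierCoeff_le (h : IsWeakTensorPassiveVectorOn A T 𝔸 b w₀ w) (k : d → ℤ) :
    ∃ K : ℝ, 0 ≤ K ∧ ∀ᵐ τ ∂(volume.restrict (Ioo 0 T)),
      ‖mFourierCoeff (FunctionSpaces.EuclideanSpace.complexify ∘ w τ) k‖ ≤ K := by
  obtain ⟨C₁, hC₁⟩ := h.exists_eLpNorm_le
  refine ⟨C₁, C₁.2, ?_⟩
  filter_upwards [hC₁, h.ae_memLp_two] with τ hτ hm
  exact (norm_mFourierCoeff_complexify_le₄ (hm.integrable one_le_two) k).trans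
    (integral_norm_le_of_eLpNorm_two_le₄ hm hτ)

/-- The mode pairings are essentially bounded: `|⟪ŵ(τ)(k), z⟫| ≤ K` for a.e. `τ ∈ (0,T)`.
[cite: DiPernaLions1989, §II.1 (12)–(14)] -/
theorem exists_ae_norm_inner_mFourierCoeff_le (h : IsWeakTensorPassiveVectorOn A T 𝔸 b w₀ w) (k : d → ℤ)
    (z : EuclideanSpace ℂ d) :
    ∃ K : ℝ, ∀ᵐ τ ∂(volume.restrict (Ioo 0 T)),
      ‖⟪mFourierCoeff (FunctionSpaces.EuclideanSpace.complexify ∘ w τ) k, z⟫_ℂ‖ ≤ K := by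
  obtain ⟨C₁, _, hC₁⟩ := h.exists_ae_norm_mFourierCoeff_le k
  refine ⟨C₁ * ‖z‖, ?_⟩
  filter_upwards [hC₁] with τ hτ
  exact (norm_inner_le_norm _ _).trans (mul_le_mul_of_nonneg_right hτ (norm_nonneg _))

/-- Integrability on `(0,T)` of `conj α · H` for the mode pairing `α(τ) = ⟪ŵ(τ)(k), z⟫` (essentially
bounded) and any `H ∈ L¹(0,T)`. [cite: DiPernaLions1989, §II.1 (12)–(14)] -/
theorem integrableOn_conj_inner_mul (h : IsWeakTensorPassiveVectorOn A T 𝔸 b w₀ w) (k : d → ℤ)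
    (z : EuclideanSpace ℂ d) {H : ℝ → ℂ} (hH : IntegrableOn H (Ioo 0 T) volume) :
    IntegrableOn (fun τ => conj ⟪mFourierCoeff (FunctionSpaces.EuclideanSpace.complexify ∘ w τ) k, z⟫_ℂ * H τ)
      (Ioo 0 T) volume := by
  obtain ⟨K, hK⟩ := h.exists_ae_norm_inner_mFourierCoeff_le k z
  have hαm : AEStronglyMeasurable
      (fun τ => conj ⟪mFourierCoeff (FunctionSpaces.EuclideanSpace.complexify ∘ w τ) k, z⟫_ℂ)
      (volume.restrict (Ioo 0 T)) :=
    (continuous_conj.comp_aestronglyMeasurable ((h.integrableOn_mFourierCoeff k).inner_const z).aestronglyMeasurable)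
  refine Integrable.bdd_mul (c := K) hH hαm ?_
  filter_upwards [hK] with τ hτ
  rwa [Complex.norm_conj]

/-- The squared mode pairings `τ ↦ |⟪ŵ(τ)(k), z⟫|²` are integrable on `(0,T)` (essentially bounded).
[cite: RobinsonRodrigoSadowski2016, §4.2 (Galerkin energy estimate)] -/
theorem integrableOn_norm_sq_inner (h : IsWeakTensorPassiveVectorOn A T 𝔸 b w₀ w) (k : d → ℤ)
    (z : EuclideanSpace ℂ d) :
    IntegrableOn (fun τ => ‖⟪mFourierCoeff (FunctionSpaces.EuclideanSpace.complexify ∘ w τ) k, z⟫_ℂ‖ ^ 2)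
      (Ioo 0 T) volume := by
  obtain ⟨K, hK⟩ := h.exists_ae_norm_inner_mFourierCoeff_le k z
  have hm : AEStronglyMeasurable
      (fun τ => ‖⟪mFourierCoeff (FunctionSpaces.EuclideanSpace.complexify ∘ w τ) k, z⟫_ℂ‖ ^ 2)
      (volume.restrict (Ioo 0 T)) :=
    (((h.integrableOn_mFourierCoeff k).inner_const z).aestronglyMeasurable.norm.pow 2)
  refine IntegrableOn.of_bound measure_Ioo_lt_top hm (K ^ 2) ?_
  filter_upwards [hK] with τ hτ
  rw [Real.norm_eq_abs, abs_of_nonneg (sq_nonneg _)]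
  exact pow_le_pow_left₀ (norm_nonneg _) hτ 2

/-- The squared modes `τ ↦ ‖ŵ(τ)(k)‖²` are integrable on `(0,T)` (essentially bounded).
[cite: RobinsonRodrigoSadowski2016, §4.2 (Galerkin energy estimate)] -/
theorem integrableOn_norm_sq_mFourierCoeff (h : IsWeakTensorPassiveVectorOn A T 𝔸 b w₀ w) (k : d → ℤ) :
    IntegrableOn (fun τ => ‖mFourierCoeff (FunctionSpaces.EuclideanSpace.complexify ∘ w τ) k‖ ^ 2)
      (Ioo 0 T) volume := by
  obtain ⟨K, _, hK⟩ := h.exists_ae_norm_mFourierCoeff_le k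
  have hm : AEStronglyMeasurable
      (fun τ => ‖mFourierCoeff (FunctionSpaces.EuclideanSpace.complexify ∘ w τ) k‖ ^ 2)
      (volume.restrict (Ioo 0 T)) :=
    ((h.integrableOn_mFourierCoeff k).aestronglyMeasurable.norm.pow 2)
  refine IntegrableOn.of_bound measure_Ioo_lt_top hm (K ^ 2) ?_
  filter_upwards [hK] with τ hτ
  rw [Real.norm_eq_abs, abs_of_nonneg (sq_nonneg _)]
  exact pow_le_pow_left₀ (norm_nonneg _) hτ 2

/-- The viscous mode pairing `τ ↦ ⟪ŵ(τ)(k), T_𝔸(k) ŵ(τ)(k)⟫` is integrable on `(0,T)` (essentially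
bounded, `T_𝔸(k)` bounded). [cite: Frisch1995Turbulence, §9.6.3 eq. (9.57) p. 233] -/
theorem integrableOn_inner_symbT (h : IsWeakTensorPassiveVectorOn A T 𝔸 b w₀ w) (k : d → ℤ) :
    IntegrableOn (fun τ => ⟪mFourierCoeff (FunctionSpaces.EuclideanSpace.complexify ∘ w τ) k,
      symbT 𝔸 k (mFourierCoeff (FunctionSpaces.EuclideanSpace.complexify ∘ w τ) k)⟫_ℂ) (Ioo 0 T) volume := by
  obtain ⟨K, hK0, hK⟩ := h.exists_ae_norm_mFourierCoeff_le k
  obtain ⟨C, hC0, hC⟩ := exists_norm_symbT_le 𝔸 k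
  have hXm : AEStronglyMeasurable (fun τ => mFourierCoeff (FunctionSpaces.EuclideanSpace.complexify ∘ w τ) k)
      (volume.restrict (Ioo 0 T)) := (h.integrableOn_mFourierCoeff k).aestronglyMeasurable
  have hm : AEStronglyMeasurable (fun τ => ⟪mFourierCoeff (FunctionSpaces.EuclideanSpace.complexify ∘ w τ) k,
      symbT 𝔸 k (mFourierCoeff (FunctionSpaces.EuclideanSpace.complexify ∘ w τ) k)⟫_ℂ)
      (volume.restrict (Ioo 0 T)) :=
    hXm.inner ((continuous_symbT 𝔸 k).comp_aestronglyMeasurable hXm)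
  refine IntegrableOn.of_bound measure_Ioo_lt_top hm (K * (C * K)) ?_
  filter_upwards [hK] with τ hτ
  exact (norm_inner_le_norm _ _).trans
    (mul_le_mul hτ ((hC _).trans (mul_le_mul_of_nonneg_left hτ hC0)) (norm_nonneg _) hK0)

/-- Integrability on `(0,T)` of the transport part `τ ↦ B_τ(z)` of the mode right-hand side for a
fixed `z`. [cite: RobinsonRodrigoSadowski2016, §4.2 (Galerkin energy estimate)] -/
theorem integrableOn_modeRHS_form (h : IsWeakTensorPassiveVectorOn A T 𝔸 b w₀ w) (k : d → ℤ)
    (z : EuclideanSpace ℂ d) :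
    IntegrableOn (fun τ =>
      (∑ j, (2 * Real.pi * I * (k j)) *
          ⟪mFourierCoeff (FunctionSpaces.EuclideanSpace.complexify ∘ fun x => b τ x j • w τ x) k, z⟫_ℂ) +
        (A : ℂ) * ∑ j, (2 * Real.pi * I * (k j)) *
          ⟪mFourierCoeff (FunctionSpaces.EuclideanSpace.complexify ∘ fun x => w τ x j • b τ x) k, z⟫_ℂ)
      (Ioo 0 T) volume :=
  (integrable_finsetSum _ fun j _ => ((h.integrableOn_mFourierCoeff_carrier_smul j k).inner_const z).const_mul _).add
    ((integrable_finsetSum _ fun j _ =>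
      ((h.integrableOn_mFourierCoeff_smul_carrier j k).inner_const z).const_mul _).const_mul _)

/-- The flux energies `γ_k(τ) = ∑ⱼ (‖𝓕(bⱼw)(τ)(k)‖² + ‖𝓕(wⱼb)(τ)(k)‖²)` are integrable on `(0,T)` when
the carrier is bounded by `M`. [cite: RobinsonRodrigoSadowski2016, §4.2 (Galerkin energy estimate)] -/
theorem integrableOn_fluxEnergy (h : IsWeakTensorPassiveVectorOn A T 𝔸 b w₀ w) {M : ℝ} (hM : 0 ≤ M)
    (hbM : ∀ᵐ q ∂(((volume : Measure ℝ).restrict (Ioo 0 T)).prod (volume : Measure (UnitAddTorus d))),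
      ‖b q.1 q.2‖ ≤ M) (k : d → ℤ) :
    IntegrableOn (fun τ => ∑ j,
      (‖mFourierCoeff (FunctionSpaces.EuclideanSpace.complexify ∘ fun x => b τ x j • w τ x) k‖ ^ 2 +
        ‖mFourierCoeff (FunctionSpaces.EuclideanSpace.complexify ∘ fun x => w τ x j • b τ x) k‖ ^ 2))
      (Ioo 0 T) volume := by
  obtain ⟨C, hC⟩ := h.ae_lintegral_sq_le
  have hFi : ∀ j, IntegrableOn (fun τ =>
      mFourierCoeff (FunctionSpaces.EuclideanSpace.complexify ∘ fun x => b τ x j • w τ x) k) (Ioo 0 T) volume :=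
    fun j => h.integrableOn_mFourierCoeff_carrier_smul j k
  have hGi : ∀ j, IntegrableOn (fun τ =>
      mFourierCoeff (FunctionSpaces.EuclideanSpace.complexify ∘ fun x => w τ x j • b τ x) k) (Ioo 0 T) volume :=
    fun j => h.integrableOn_mFourierCoeff_smul_carrier j k
  have hslice := h.ae_tsum_enorm_sq_mFourierCoeff_products_le hM hbM
  have hm : AEStronglyMeasurable (fun τ => ∑ j,
      (‖mFourierCoeff (FunctionSpaces.EuclideanSpace.complexify ∘ fun x => b τ x j • w τ x) k‖ ^ 2 +
        ‖mFourierCoeff (FunctionSpaces.EuclideanSpace.complexify ∘ fun x => w τ x j • b τ x) k‖ ^ 2))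
      (volume.restrict (Ioo 0 T)) :=
    Finset.aestronglyMeasurable_fun_sum _ fun j _ =>
      ((hFi j).aestronglyMeasurable.norm.pow 2).add ((hGi j).aestronglyMeasurable.norm.pow 2)
  refine IntegrableOn.of_bound measure_Ioo_lt_top hm (∑ _j : d, (M ^ 2 * C + M ^ 2 * C)) ?_
  filter_upwards [hslice, hC] with τ hτ hτC
  rw [Real.norm_eq_abs, abs_of_nonneg (Finset.sum_nonneg fun j _ => by positivity)]
  refine Finset.sum_le_sum fun j _ => ?_
  have conv : ∀ (X : EuclideanSpace ℂ d), ‖X‖ₑ ^ 2 ≤ ENNReal.ofReal (M ^ 2) * C → ‖X‖ ^ 2 ≤ M ^ 2 * C := by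
    intro X hX
    have h2 : ‖X‖ₑ ^ 2 = ENNReal.ofReal (‖X‖ ^ 2) := by
      rw [← ofReal_norm, ENNReal.ofReal_pow (norm_nonneg _)]
    rw [h2, ← ENNReal.ofReal_coe_nnreal, ← ENNReal.ofReal_mul (sq_nonneg _)] at hX
    exact (ENNReal.ofReal_le_ofReal_iff (by positivity)).1 hX
  exact add_le_add (conv _ (((ENNReal.le_tsum k).trans (hτ.2 j).1).trans (mul_le_mul_right hτC _)))
    (conv _ (((ENNReal.le_tsum k).trans (hτ.2 j).2).trans (mul_le_mul_right hτC _)))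

/-- **Per-mode energy identity in Fourier variables (tested form, tensor viscosity).** For a
frequency `k`, a transversal `z ∈ ℂ^d` (`k · z = 0`) and a.e. `t ∈ (0,T)`, with
`α(t) = ⟪ŵ(t)(k), z⟫_ℂ` and `H_τ(z) = −4π² ⟪ŵ(τ)(k), T_𝔸(k) z⟫ + B_τ(z)`:
`|α(t)|² = |⟪ŵ₀(k), z⟫|² + 2 ∫_{(0,t]} Re (conj α(τ) · H_τ(z)) dτ`
(real and imaginary parts of `PassiveVectorTensorFourier.ae_inner_mFourierCoeff_eq`, squared by the
product rule for a.e. primitives and added). [cite: RobinsonRodrigoSadowski2016, §4.2 (Galerkin energy estimate)] -/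
theorem ae_sq_norm_inner_mFourierCoeff_eq (h : IsWeakTensorPassiveVectorOn A T 𝔸 b w₀ w)
    (hw₀ : Integrable w₀ volume) (k : d → ℤ) {z : EuclideanSpace ℂ d}
    (hz : ∑ j, (k j : ℂ) * z j = 0) :
    ∀ᵐ t ∂(volume.restrict (Ioo 0 T)),
      ‖⟪mFourierCoeff (FunctionSpaces.EuclideanSpace.complexify ∘ w t) k, z⟫_ℂ‖ ^ 2 =
        ‖⟪mFourierCoeff (FunctionSpaces.EuclideanSpace.complexify ∘ w₀) k, z⟫_ℂ‖ ^ 2 +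
        2 * ∫ τ in Ioc 0 t,
          (conj ⟪mFourierCoeff (FunctionSpaces.EuclideanSpace.complexify ∘ w τ) k, z⟫_ℂ *
            ((-(4 * Real.pi ^ 2 : ℝ) : ℂ) *
                ⟪mFourierCoeff (FunctionSpaces.EuclideanSpace.complexify ∘ w τ) k, symbT 𝔸 k z⟫_ℂ +
              ((∑ j, (2 * Real.pi * I * (k j)) *
                  ⟪mFourierCoeff (FunctionSpaces.EuclideanSpace.complexify ∘ fun x => b τ x j • w τ x) k, z⟫_ℂ) +
                (A : ℂ) * ∑ j, (2 * Real.pi * I * (k j)) *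
                  ⟪mFourierCoeff (FunctionSpaces.EuclideanSpace.complexify ∘ fun x => w τ x j • b τ x) k, z⟫_ℂ))).re := by
  -- names
  set α : ℝ → ℂ := fun t => ⟪mFourierCoeff (FunctionSpaces.EuclideanSpace.complexify ∘ w t) k, z⟫_ℂ with hα
  set α₀ : ℂ := ⟪mFourierCoeff (FunctionSpaces.EuclideanSpace.complexify ∘ w₀) k, z⟫_ℂ with hα₀
  set H : ℝ → ℂ := fun τ => (-(4 * Real.pi ^ 2 : ℝ) : ℂ) *
      ⟪mFourierCoeff (FunctionSpaces.EuclideanSpace.complexify ∘ w τ) k, symbT 𝔸 k z⟫_ℂ +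
    ((∑ j, (2 * Real.pi * I * (k j)) *
        ⟪mFourierCoeff (FunctionSpaces.EuclideanSpace.complexify ∘ fun x => b τ x j • w τ x) k, z⟫_ℂ) +
      (A : ℂ) * ∑ j, (2 * Real.pi * I * (k j)) *
        ⟪mFourierCoeff (FunctionSpaces.EuclideanSpace.complexify ∘ fun x => w τ x j • b τ x) k, z⟫_ℂ) with hH
  have hHi : IntegrableOn H (Ioo 0 T) volume := h.integrableOn_modeRHS k z
  -- the modewise identity and its real and imaginary parts
  have hid : ∀ᵐ t ∂(volume.restrict (Ioo 0 T)), α t = α₀ + ∫ τ in Ioc 0 t, H τ :=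
    h.ae_inner_mFourierCoeff_eq hw₀ k hz
  have hre : ∀ᵐ t ∂(volume.restrict (Ioo 0 T)), (α t).re = α₀.re + ∫ τ in Ioc 0 t, (H τ).re := by
    filter_upwards [hid, ae_restrict_mem measurableSet_Ioo] with t ht htT
    rw [ht, Complex.add_re, re_integral_eq (hHi.mono_set (Ioc_subset_Ioo_right htT.2))]
  have him : ∀ᵐ t ∂(volume.restrict (Ioo 0 T)), (α t).im = α₀.im + ∫ τ in Ioc 0 t, (H τ).im := by
    filter_upwards [hid, ae_restrict_mem measurableSet_Ioo] with t ht htT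
    rw [ht, Complex.add_im, im_integral_eq (hHi.mono_set (Ioc_subset_Ioo_right htT.2))]
  have h1 := ae_sq_eq_of_ae_eq_add_setIntegral₄ hHi.re hre
  have h2 := ae_sq_eq_of_ae_eq_add_setIntegral₄ hHi.im him
  -- integrability of the products on `(0,T)`
  have hαi : IntegrableOn α (Ioo 0 T) volume := (h.integrableOn_mFourierCoeff k).inner_const z
  obtain ⟨K, hK⟩ := h.exists_ae_norm_inner_mFourierCoeff_le k z
  have hP1 : IntegrableOn (fun τ => (H τ).re * (α τ).re) (Ioo 0 T) volume := by
    have hαm : AEStronglyMeasurable (fun τ => (α τ).re) (volume.restrict (Ioo 0 T)) :=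
      Complex.continuous_re.comp_aestronglyMeasurable hαi.aestronglyMeasurable
    refine Integrable.mul_bdd (c := K) hHi.re hαm ?_
    filter_upwards [hK] with τ hτ
    rw [Real.norm_eq_abs]
    exact (Complex.abs_re_le_norm _).trans hτ
  have hP2 : IntegrableOn (fun τ => (H τ).im * (α τ).im) (Ioo 0 T) volume := by
    have hαm : AEStronglyMeasurable (fun τ => (α τ).im) (volume.restrict (Ioo 0 T)) :=
      Complex.continuous_im.comp_aestronglyMeasurable hαi.aestronglyMeasurable
    refine Integrable.mul_bdd (c := K) hHi.im hαm ?_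
    filter_upwards [hK] with τ hτ
    rw [Real.norm_eq_abs]
    exact (Complex.abs_im_le_norm _).trans hτ
  filter_upwards [h1, h2, ae_restrict_mem measurableSet_Ioo] with t ht1 ht2 htT
  simp only [RCLike.re_to_complex, RCLike.im_to_complex] at ht1 ht2
  have hsub : Ioc 0 t ⊆ Ioo 0 T := Ioc_subset_Ioo_right htT.2
  -- assemble `|α|² = re² + im²`
  rw [norm_sq_eq_re_sq_add_im_sq₄, norm_sq_eq_re_sq_add_im_sq₄ α₀]
  rw [show (⟪mFourierCoeff (FunctionSpaces.EuclideanSpace.complexify ∘ w t) k, z⟫_ℂ) = α t from rfl, ht1, ht2,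
    add_add_add_comm, ← mul_add, ← integral_add (hP1.mono_set hsub) (hP2.mono_set hsub)]
  congr 2
  refine integral_congr_ae (ae_of_all _ fun τ => ?_)
  have e1 : (H τ).re * (α τ).re + (H τ).im * (α τ).im = (conj (α τ) * H τ).re := by
    rw [← re_mul_re_add_im_mul_im₄]
    ring
  exact e1

/-- The zero mode of a weak solution is constant: `ŵ(t)(0) = ŵ₀(0)` for a.e. `t` (test with the
constant fields `eᵢ`; `T_𝔸(0) = 0`). [cite: RobinsonRodrigoSadowski2016, §4.2 (Galerkin energy estimate)] -/
theorem ae_mFourierCoeff_zero_eq (h : IsWeakTensorPassiveVectorOn A T 𝔸 b w₀ w) (hw₀ : Integrable w₀ volume) :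
    ∀ᵐ t ∂(volume.restrict (Ioo 0 T)),
      mFourierCoeff (FunctionSpaces.EuclideanSpace.complexify ∘ w t) 0 =
        mFourierCoeff (FunctionSpaces.EuclideanSpace.complexify ∘ w₀) 0 := by
  have hz : ∀ i : d, ∑ j, (((0 : d → ℤ) j : ℤ) : ℂ) * (EuclideanSpace.single i (1 : ℂ) : EuclideanSpace ℂ d) j = 0 := by
    intro i
    simp
  have hall := ae_all_iff.2 fun i => h.ae_inner_mFourierCoeff_eq hw₀ 0 (hz i)
  filter_upwards [hall] with t ht
  ext i
  have hi := ht i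
  have h0 : ∫ τ in Ioc 0 t,
      ((-(4 * Real.pi ^ 2 : ℝ) : ℂ) *
          ⟪mFourierCoeff (FunctionSpaces.EuclideanSpace.complexify ∘ w τ) 0,
            symbT 𝔸 0 (EuclideanSpace.single i (1 : ℂ))⟫_ℂ +
        ((∑ j, (2 * Real.pi * I * ((0 : d → ℤ) j)) *
            ⟪mFourierCoeff (FunctionSpaces.EuclideanSpace.complexify ∘ fun x => b τ x j • w τ x) 0,
              EuclideanSpace.single i (1 : ℂ)⟫_ℂ) +
          (A : ℂ) * ∑ j, (2 * Real.pi * I * ((0 : d → ℤ) j)) *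
            ⟪mFourierCoeff (FunctionSpaces.EuclideanSpace.complexify ∘ fun x => w τ x j • b τ x) 0,
              EuclideanSpace.single i (1 : ℂ)⟫_ℂ)) = 0 := by
    rw [integral_congr_ae (ae_of_all _ fun τ => ?_), integral_zero]
    simp
  rw [h0, add_zero, EuclideanSpace.inner_single_right, EuclideanSpace.inner_single_right, one_mul, one_mul] at hi
  exact (starRingEnd ℂ).injective hi

/-- **The energy identity of one Fourier mode, vector form (tensor viscosity).** For a weak solution
with datum `w₀ ∈ L²` weakly divergence free, every frequency `k` and a.e. `t ∈ (0,T)`: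
`‖ŵ(t)(k)‖² = ‖ŵ₀(k)‖² + 2 ∫_{(0,t]} Re (−4π² ⟪ŵ(τ)(k), T_𝔸(k) ŵ(τ)(k)⟫ + B_τ(ŵ(τ)(k))) dτ`,
`B_τ(z) = ∑ⱼ 2πikⱼ ⟪𝓕(bⱼw)(τ)(k), z⟫ + A ∑ⱼ 2πikⱼ ⟪𝓕(wⱼb)(τ)(k), z⟫` (the tested identities summed
over an orthonormal basis of `k^⊥ ⊂ ℂ^d`, in which `ŵ(τ)(k)` lies for a.e. `τ`; Robinson–Rodrigo–
Sadowski 2016, §4.2, with Frisch's tensor). [cite: RobinsonRodrigoSadowski2016, §4.2 (Galerkin energy estimate)]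
[cite: Frisch1995Turbulence, §9.6.3 eq. (9.57) p. 233] -/
theorem ae_sq_norm_mFourierCoeff_eq (h : IsWeakTensorPassiveVectorOn A T 𝔸 b w₀ w) (hw₀ : MemLp w₀ 2 volume)
    (hdiv₀ : FunctionSpaces.Torus.IsWeaklyDivFree w₀) (k : d → ℤ) :
    ∀ᵐ t ∂(volume.restrict (Ioo 0 T)),
      ‖mFourierCoeff (FunctionSpaces.EuclideanSpace.complexify ∘ w t) k‖ ^ 2 =
        ‖mFourierCoeff (FunctionSpaces.EuclideanSpace.complexify ∘ w₀) k‖ ^ 2 +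
        2 * ∫ τ in Ioc 0 t,
          ((-(4 * Real.pi ^ 2 : ℝ) : ℂ) *
              ⟪mFourierCoeff (FunctionSpaces.EuclideanSpace.complexify ∘ w τ) k,
                symbT 𝔸 k (mFourierCoeff (FunctionSpaces.EuclideanSpace.complexify ∘ w τ) k)⟫_ℂ +
            ((∑ j, (2 * Real.pi * I * (k j)) *
                ⟪mFourierCoeff (FunctionSpaces.EuclideanSpace.complexify ∘ fun x => b τ x j • w τ x) k,
                  mFourierCoeff (FunctionSpaces.EuclideanSpace.complexify ∘ w τ) k⟫_ℂ) +
              (A : ℂ) * ∑ j, (2 * Real.pi * I * (k j)) *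
                ⟪mFourierCoeff (FunctionSpaces.EuclideanSpace.complexify ∘ fun x => w τ x j • b τ x) k,
                  mFourierCoeff (FunctionSpaces.EuclideanSpace.complexify ∘ w τ) k⟫_ℂ)).re := by
  have hw₀i : Integrable w₀ volume := hw₀.integrable one_le_two
  -- names
  set X : ℝ → EuclideanSpace ℂ d := fun t => mFourierCoeff (FunctionSpaces.EuclideanSpace.complexify ∘ w t) k with hX
  set X₀ : EuclideanSpace ℂ d := mFourierCoeff (FunctionSpaces.EuclideanSpace.complexify ∘ w₀) k with hX₀
  set F : d → ℝ → EuclideanSpace ℂ d := fun j τ =>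
    mFourierCoeff (FunctionSpaces.EuclideanSpace.complexify ∘ fun x => b τ x j • w τ x) k with hF
  set G : d → ℝ → EuclideanSpace ℂ d := fun j τ =>
    mFourierCoeff (FunctionSpaces.EuclideanSpace.complexify ∘ fun x => w τ x j • b τ x) k with hG
  by_cases hk : k = 0
  · -- the zero mode is constant and the right-hand side vanishes
    subst hk
    filter_upwards [h.ae_mFourierCoeff_zero_eq hw₀i] with t ht
    have h0 : ∫ τ in Ioc 0 t,
        ((-(4 * Real.pi ^ 2 : ℝ) : ℂ) * ⟪X τ, symbT 𝔸 0 (X τ)⟫_ℂ +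
          ((∑ j, (2 * Real.pi * I * ((0 : d → ℤ) j)) * ⟪F j τ, X τ⟫_ℂ) +
            (A : ℂ) * ∑ j, (2 * Real.pi * I * ((0 : d → ℤ) j)) * ⟪G j τ, X τ⟫_ℂ)).re = 0 := by
      rw [integral_congr_ae (ae_of_all _ fun τ => ?_), integral_zero]
      simp
    rw [h0, mul_zero, add_zero]
    exact congrArg (fun v : EuclideanSpace ℂ d => ‖v‖ ^ 2) ht
  -- `k ≠ 0`: sum the tested identities over an orthonormal basis of `k^⊥`
  set S : Submodule ℂ (EuclideanSpace ℂ d) :=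
    (ℂ ∙ (WithLp.toLp 2 (fun j => ((k j : ℤ) : ℂ)) : EuclideanSpace ℂ d))ᗮ with hS
  let bS := stdOrthonormalBasis ℂ S
  set e : Fin (Module.finrank ℂ S) → EuclideanSpace ℂ d := fun i => (bS i : EuclideanSpace ℂ d) with he
  have he_tr : ∀ i, ∑ j, (k j : ℂ) * e i j = 0 := fun i => (mem_orthogonal_waveVec_iff k _).1 (bS i).2
  have hX₀S : X₀ ∈ S := (mem_orthogonal_waveVec_iff k X₀).2 (hdiv₀.sum_mul_mFourierCoeff_eq_zero hw₀ k)
  have hXt := h.ae_sum_mul_mFourierCoeff_eq_zero k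
  -- the mode right-hand side at `z`
  set H : EuclideanSpace ℂ d → ℝ → ℂ := fun z τ =>
    (-(4 * Real.pi ^ 2 : ℝ) : ℂ) * ⟪X τ, symbT 𝔸 k z⟫_ℂ +
      ((∑ j, (2 * Real.pi * I * (k j)) * ⟪F j τ, z⟫_ℂ) + (A : ℂ) * ∑ j, (2 * Real.pi * I * (k j)) * ⟪G j τ, z⟫_ℂ)
    with hH
  have hHi : ∀ z, IntegrableOn (H z) (Ioo 0 T) volume := fun z => h.integrableOn_modeRHS k z
  have hall := ae_all_iff.2 fun i => h.ae_sq_norm_inner_mFourierCoeff_eq hw₀i k (z := e i) (he_tr i)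
  -- integrability of the summands on `(0,T)`
  have hIi : ∀ i, IntegrableOn (fun τ => (conj ⟪X τ, e i⟫_ℂ * H (e i) τ).re) (Ioo 0 T) volume :=
    fun i => (h.integrableOn_conj_inner_mul k (e i) (hHi (e i))).re
  -- the pointwise basis identity for a transversal `X τ`
  have hframe : ∀ᵐ τ ∂(volume.restrict (Ioo 0 T)),
      ∑ i, (conj ⟪X τ, e i⟫_ℂ * H (e i) τ).re = (H (X τ) τ).re := by
    filter_upwards [hXt] with τ hτ
    have hXS : X τ ∈ S := (mem_orthogonal_waveVec_iff k (X τ)).2 hτ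
    rw [← Complex.re_sum]
    congr 1
    have hlin := modeRHS_sum_smul Finset.univ 𝔸 k A (X τ) (fun j => F j τ) (fun j => G j τ)
      (fun i => conj ⟪X τ, e i⟫_ℂ) e
    rw [sum_conj_inner_smul_onb₄ bS hXS] at hlin
    rw [hH]
    exact hlin.symm
  filter_upwards [hall, hXt, ae_restrict_mem measurableSet_Ioo] with t ht hXtt htT
  have hsub : Ioc 0 t ⊆ Ioo 0 T := Ioc_subset_Ioo_right htT.2
  have hXS : X t ∈ S := (mem_orthogonal_waveVec_iff k (X t)).2 hXtt
  -- sum the basis identities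
  have hsum : ∑ i, ‖⟪X t, e i⟫_ℂ‖ ^ 2 = ∑ i, (‖⟪X₀, e i⟫_ℂ‖ ^ 2 +
      2 * ∫ τ in Ioc 0 t, (conj ⟪X τ, e i⟫_ℂ * H (e i) τ).re) :=
    Finset.sum_congr rfl fun i _ => ht i
  rw [sum_sq_norm_inner_onb₄ bS hXS, Finset.sum_add_distrib, sum_sq_norm_inner_onb₄ bS hX₀S, ← Finset.mul_sum,
    ← integral_finsetSum _ (fun i _ => (hIi i).mono_set hsub),
    integral_congr_ae (ae_restrict_of_ae_restrict_of_subset hsub hframe)] at hsum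
  rw [hX] at hsum
  exact hsum

/-- **The modewise dissipation bound (tensor viscosity in a Legendre–Hadamard window).** For
`NearIso 𝔸 lo hi` with `0 < lo`, a carrier bounded by `M` a.e. on `(0,T) × T^d`, a datum `w₀ ∈ L²`
weakly divergence free, every `k` and a.e. `t ∈ (0,T)`:
`‖ŵ(t)(k)‖² + 4π² lo |k|² ∫_{(0,t]} ‖ŵ(τ)(k)‖² dτ ≤ ‖ŵ₀(k)‖² + ((1 + A²)/lo) ∫_{(0,t]} γ_k(τ) dτ`,
`γ_k = ∑ⱼ (‖𝓕(bⱼw)(k)‖² + ‖𝓕(wⱼb)(k)‖²)` (the energy identity of the mode, the coercivity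
`lo|k|²‖X‖² ≤ Re ⟪X, T_𝔸(k) X⟫` on `k^⊥` and Young's inequality `2 Re B(X) ≤ 4π² lo|k|²‖X‖² + (1+A²)γ_k/lo`;
Robinson–Rodrigo–Sadowski 2016, (4.20), mode by mode, with `ν ↦ lo`).
[cite: RobinsonRodrigoSadowski2016, §4.2 (4.20)] [cite: Giaquinta1983MultipleIntegrals, Ch. III §2 eq. (2.2)] -/
theorem ae_sq_norm_add_dissipation_le (h : IsWeakTensorPassiveVectorOn A T 𝔸 b w₀ w)
    {lo hi : ℝ} (h𝔸 : NearIso 𝔸 lo hi) (hlo : 0 < lo)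
    (hw₀ : MemLp w₀ 2 volume) (hdiv₀ : FunctionSpaces.Torus.IsWeaklyDivFree w₀) {M : ℝ} (hM : 0 ≤ M)
    (hbM : ∀ᵐ q ∂(((volume : Measure ℝ).restrict (Ioo 0 T)).prod (volume : Measure (UnitAddTorus d))),
      ‖b q.1 q.2‖ ≤ M) (k : d → ℤ) :
    ∀ᵐ t ∂(volume.restrict (Ioo 0 T)),
      ‖mFourierCoeff (FunctionSpaces.EuclideanSpace.complexify ∘ w t) k‖ ^ 2 +
          4 * Real.pi ^ 2 * lo * FunctionSpaces.Torus.freqNormSq k *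
            ∫ τ in Ioc 0 t, ‖mFourierCoeff (FunctionSpaces.EuclideanSpace.complexify ∘ w τ) k‖ ^ 2 ≤
        ‖mFourierCoeff (FunctionSpaces.EuclideanSpace.complexify ∘ w₀) k‖ ^ 2 +
          ((1 + A ^ 2) / lo) * ∫ τ in Ioc 0 t, ∑ j,
            (‖mFourierCoeff (FunctionSpaces.EuclideanSpace.complexify ∘ fun x => b τ x j • w τ x) k‖ ^ 2 +
              ‖mFourierCoeff (FunctionSpaces.EuclideanSpace.complexify ∘ fun x => w τ x j • b τ x) k‖ ^ 2) := by
  set N : ℝ := FunctionSpaces.Torus.freqNormSq k with hN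
  set X : ℝ → EuclideanSpace ℂ d := fun t => mFourierCoeff (FunctionSpaces.EuclideanSpace.complexify ∘ w t) k with hX
  set F : d → ℝ → EuclideanSpace ℂ d := fun j τ =>
    mFourierCoeff (FunctionSpaces.EuclideanSpace.complexify ∘ fun x => b τ x j • w τ x) k with hF
  set G : d → ℝ → EuclideanSpace ℂ d := fun j τ =>
    mFourierCoeff (FunctionSpaces.EuclideanSpace.complexify ∘ fun x => w τ x j • b τ x) k with hG
  set γ : ℝ → ℝ := fun τ => ∑ j, (‖F j τ‖ ^ 2 + ‖G j τ‖ ^ 2) with hγ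
  have hγi : IntegrableOn γ (Ioo 0 T) volume := h.integrableOn_fluxEnergy hM hbM k
  obtain ⟨C₁, hC₁0, hXb⟩ := h.exists_ae_norm_mFourierCoeff_le k
  have hXm : AEStronglyMeasurable X (volume.restrict (Ioo 0 T)) := (h.integrableOn_mFourierCoeff k).aestronglyMeasurable
  have hI3 : IntegrableOn (fun τ => ‖X τ‖ ^ 2) (Ioo 0 T) volume := h.integrableOn_norm_sq_mFourierCoeff k
  -- `Re H_τ(X τ)` is integrable
  have hFi : ∀ j, IntegrableOn (F j) (Ioo 0 T) volume := fun j => h.integrableOn_mFourierCoeff_carrier_smul j k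
  have hGi : ∀ j, IntegrableOn (G j) (Ioo 0 T) volume := fun j => h.integrableOn_mFourierCoeff_smul_carrier j k
  have hFX : ∀ j, IntegrableOn (fun τ => ⟪F j τ, X τ⟫_ℂ) (Ioo 0 T) volume := by
    intro j
    refine Integrable.mono' ((hFi j).norm.mul_const C₁) ((hFi j).aestronglyMeasurable.inner hXm) ?_
    filter_upwards [hXb] with τ hτ
    exact (norm_inner_le_norm _ _).trans (mul_le_mul_of_nonneg_left hτ (norm_nonneg _))
  have hGX : ∀ j, IntegrableOn (fun τ => ⟪G j τ, X τ⟫_ℂ) (Ioo 0 T) volume := by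
    intro j
    refine Integrable.mono' ((hGi j).norm.mul_const C₁) ((hGi j).aestronglyMeasurable.inner hXm) ?_
    filter_upwards [hXb] with τ hτ
    exact (norm_inner_le_norm _ _).trans (mul_le_mul_of_nonneg_left hτ (norm_nonneg _))
  have hBi : IntegrableOn (fun τ => ((∑ j, (2 * Real.pi * I * (k j)) * ⟪F j τ, X τ⟫_ℂ) +
      (A : ℂ) * ∑ j, (2 * Real.pi * I * (k j)) * ⟪G j τ, X τ⟫_ℂ)) (Ioo 0 T) volume :=
    (integrable_finsetSum _ fun j _ => (hFX j).const_mul _).add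
      ((integrable_finsetSum _ fun j _ => (hGX j).const_mul _).const_mul _)
  have hTi : IntegrableOn (fun τ => ⟪X τ, symbT 𝔸 k (X τ)⟫_ℂ) (Ioo 0 T) volume := h.integrableOn_inner_symbT k
  have hHi : IntegrableOn (fun τ => ((-(4 * Real.pi ^ 2 : ℝ) : ℂ) * ⟪X τ, symbT 𝔸 k (X τ)⟫_ℂ +
      ((∑ j, (2 * Real.pi * I * (k j)) * ⟪F j τ, X τ⟫_ℂ) +
        (A : ℂ) * ∑ j, (2 * Real.pi * I * (k j)) * ⟪G j τ, X τ⟫_ℂ)).re) (Ioo 0 T) volume :=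
    ((hTi.const_mul _).add hBi).re
  set ν' : ℝ := 4 * Real.pi ^ 2 * lo * N with hν'
  set c : ℝ := (1 + A ^ 2) / lo with hc
  -- the pointwise (a.e.) inequality `2 Re H_τ(X τ) ≤ -ν' ‖X τ‖² + c γ τ`
  have hpt : ∀ᵐ τ ∂(volume.restrict (Ioo 0 T)),
      2 * ((-(4 * Real.pi ^ 2 : ℝ) : ℂ) * ⟪X τ, symbT 𝔸 k (X τ)⟫_ℂ +
        ((∑ j, (2 * Real.pi * I * (k j)) * ⟪F j τ, X τ⟫_ℂ) +
          (A : ℂ) * ∑ j, (2 * Real.pi * I * (k j)) * ⟪G j τ, X τ⟫_ℂ)).re ≤ -ν' * ‖X τ‖ ^ 2 + c * γ τ := by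
    filter_upwards [h.ae_sum_mul_mFourierCoeff_eq_zero k] with τ hτ
    have hco := lo_mul_le_re_inner_symbT h𝔸 (k := k) (z := X τ) hτ
    have hY := two_mul_re_modeRHS_le₄ hlo A k (X τ) (fun j => F j τ) (fun j => G j τ)
    rw [Complex.add_re, neg_mul, Complex.neg_re, Complex.re_ofReal_mul, hγ, hc, hν']
    simp only
    nlinarith [hco, hY, Real.pi_pos]
  filter_upwards [h.ae_sq_norm_mFourierCoeff_eq hw₀ hdiv₀ k, ae_restrict_mem measurableSet_Ioo] with t ht htT
  have hsub : Ioc 0 t ⊆ Ioo 0 T := Ioc_subset_Ioo_right htT.2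
  have haT : IntegrableOn (fun τ => -ν' * ‖X τ‖ ^ 2) (Ioo 0 T) volume := hI3.const_mul (-ν')
  have hcT : IntegrableOn (fun τ => c * γ τ) (Ioo 0 T) volume := hγi.const_mul c
  have hgT : IntegrableOn (fun τ => -ν' * ‖X τ‖ ^ 2 + c * γ τ) (Ioo 0 T) volume := haT.add hcT
  have hle : ∫ τ in Ioc 0 t, 2 * ((-(4 * Real.pi ^ 2 : ℝ) : ℂ) * ⟪X τ, symbT 𝔸 k (X τ)⟫_ℂ +
      ((∑ j, (2 * Real.pi * I * (k j)) * ⟪F j τ, X τ⟫_ℂ) +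
        (A : ℂ) * ∑ j, (2 * Real.pi * I * (k j)) * ⟪G j τ, X τ⟫_ℂ)).re ≤
      ∫ τ in Ioc 0 t, (-ν' * ‖X τ‖ ^ 2 + c * γ τ) :=
    integral_mono_ae ((hHi.mono_set hsub).const_mul 2) (hgT.mono_set hsub)
      (ae_restrict_of_ae_restrict_of_subset hsub hpt)
  have e1 : ∫ τ in Ioc 0 t, 2 * ((-(4 * Real.pi ^ 2 : ℝ) : ℂ) * ⟪X τ, symbT 𝔸 k (X τ)⟫_ℂ +
      ((∑ j, (2 * Real.pi * I * (k j)) * ⟪F j τ, X τ⟫_ℂ) +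
        (A : ℂ) * ∑ j, (2 * Real.pi * I * (k j)) * ⟪G j τ, X τ⟫_ℂ)).re =
      2 * ∫ τ in Ioc 0 t, ((-(4 * Real.pi ^ 2 : ℝ) : ℂ) * ⟪X τ, symbT 𝔸 k (X τ)⟫_ℂ +
      ((∑ j, (2 * Real.pi * I * (k j)) * ⟪F j τ, X τ⟫_ℂ) +
        (A : ℂ) * ∑ j, (2 * Real.pi * I * (k j)) * ⟪G j τ, X τ⟫_ℂ)).re :=
    integral_const_mul _ _
  have e2 : ∫ τ in Ioc 0 t, (-ν' * ‖X τ‖ ^ 2 + c * γ τ) =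
      -ν' * (∫ τ in Ioc 0 t, ‖X τ‖ ^ 2) + c * ∫ τ in Ioc 0 t, γ τ := by
    rw [integral_add (haT.mono_set hsub) (hcT.mono_set hsub), integral_const_mul, integral_const_mul]
  rw [ht]
  linarith

end IsWeakTensorPassiveVectorOn

end ModeEnergy

end Torus

end Literature.Analysis.FluidPDE

end
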